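import Literature.NumberTheory.Automorphic.Liu2021.AppendixC.HeckeEndomorphismTransposedWordSinglePiece
import Literature.AlgebraicGeometry.Motives.JacobianGaloisCoverNorm
import HarnessLib

/-!
# Liu 2021, Appendix C/D glue — matching the entries of two Hecke fan words along EQUAL PIECE INDICES (homogeneous form)

[cite: Lange2023AbelianVarietiesComplex, §4.5.2 (the norm map `N_f`; `N_f ∘ α_c = α_{f(c)} ∘ f`) and Thm. 4.5.1]
[cite: LangeRodriguez2022, §3.5.1 Prop. 3.5.1 (p. 65) (`Nm_G = f^* ∘ Nm_f`: the pull-back is pinned by the norm)]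
[cite: GortzWedhorn2020, §(3.5) Prop. 3.10 / Ex. 3.11 (p. 73) (morphisms between disjoint unions, piece by piece)]
[cite: MumfordAV1970, §19 (Hom(X,Y), first paragraph) and §7 Thm. p. 66 (Remark)]

PROOF lane (theorems only; no definition, no instance, no named fact, no `sorry`); sequel of ★ `HeckeEndomorphismTransposedWordSinglePiece`
(p762634, `pushforward_comp_inj_eq_of_index_eq`) and ★ `Motives/JacobianGaloisCoverNorm` (`Jacobian.eq_of_pushforward_comp_eq`:
`Nm_p` is right-cancellable).  THE BOOKKEEPING PROBLEM (cell `hodgecm-mathlib`, d6 `stub_RosH` glue, frame `slot_letters`, hand (G4Σ),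
A-p18 (g12) Layer 1 (ii) `hfd`): one entry of a complex Hecke word is `πY_K a ≫ (x ≫ Nm_r) ≫ ιY_K d` with `x : J_K a → J″` a PINNED
pull-back row (`Nm_p ≫ x = Σ_h Nm_h` along a piece map `p : E″ → E_K a`) and `Nm_r` the norm of a piece map `r : E″ → E_K d`.  The same
entry arises twice with DIFFERENT BUT EQUAL indices — from the single-piece brick at `(γ⁻¹, N″, K)` with indices `b″ (ch c′)`, `φ″ (ch c′)`,
and in the (hx) currency with indices `φ γ c′`, `bN c′` (equal by ★ `Morphisms.Over.pieceMap_index_eq_comp_section`, p763104) — and the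
glue wants the two `End(Y_K)`-valued entries EQUAL, with no dependent cast.  Everything here is stated for index VARIABLES `c₁ = c₂`, so the
proofs are `subst` + `cancel_mono` (the pieces `e_K c : E_K c → X_K` are monomorphisms) + right-cancellation of `Nm_p`.

* §1 `isSepQuotient_pieceMap_of_index_eq` — the quotient property of a piece map transports along an index equality (feeds the `hqz`
  of ★ `Jacobian.exists_entry_levelAdjoint(_smul)` with the (hx)-typed lift `u′ := tq′ c′ ≫ tp γ c′`).
* §2 `fan_row_eq_of_pinned_of_index_eq` — two rows `x₁ : J_K c₁ → J″`, `x₂ : J_K c₂ → J″` pinned to the SAME value along piece maps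
  `p₁`, `p₂` over one ambient map, `c₁ = c₂` ⇒ `πY_K c₁ ≫ x₁ = πY_K c₂ ≫ x₂` (`p₁ = p₂` by `cancel_mono`, then `x₁ = x₂` by ★
  `eq_of_pushforward_comp_eq`); `_of_isSmoothProjective` supplies the rational point over an algebraically closed field.
* §3 `fan_entry_eq_of_pinned_of_index_eq` (+ `_smul`, `_of_isSmoothProjective`) — §2 ⊗ ★ `pushforward_comp_inj_eq_of_index_eq`:
  `πY_K a₁ ≫ (x₁ ≫ Nm_{r₁}) ≫ ιY_K d₁ = πY_K a₂ ≫ (x₂ ≫ Nm_{r₂}) ≫ ιY_K d₂` — the letter `hfd` with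
  `fd := (m : ℤ) • (tz ≫ Nm_{tq′ c′} ≫ Nm_{tu c′})` = the adjoint of ★ `Jacobian.exists_entry_levelAdjoint_smul` VERBATIM.

All model data are HYPOTHESES; COUNT-NEUTRAL: HC_CM is proved only modulo the 7 printed citations until rung 0 closes.
-/

set_option autoImplicit false

noncomputable section

open CategoryTheory CategoryTheory.Limits AlgebraicGeometry
open Literature.AlgebraicGeometry.Motives

namespace Literature.NumberTheory.Automorphic.Liu2021.AppendixC

universe u

variable {L : Type u} [Field L] {CK : Type*} {XK : SchemeOver L} {EK : CK → SchemeOver L} (eK : ∀ c, EK c ⟶ XK)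
  (JK : ∀ c, Jacobian (EK c)) {YK : AbelianVariety L} (πK : ∀ c, YK ⟶ (JK c).J) (ιK : ∀ c, (JK c).J ⟶ YK)
  {E : SchemeOver L} (J : Jacobian E) {Δ : Type*} (act : Δ → (E ≅ E))

/-! ## §1 The quotient property of a piece map along an index equality -/

/-- **Piece maps over the same ambient map into the same piece coincide, so the quotient property transports**: if
`p₁ : E → E_K c₁`, `p₂ : E → E_K c₂` lie over one map to `X_K` (`p₁ ≫ e_K c₁ = p₂ ≫ e_K c₂`), `c₁ = c₂`, and the `e_K c` are
monomorphisms, then `p₁` is a quotient by `act` for separated test objects iff `p₂` is (indeed `p₁ = p₂` after transport).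
[cite: GortzWedhorn2020, §(3.5) Proposition 3.10 and Example 3.11 (p. 73)] [cite: MumfordAV1970, §7 Thm. p. 66 (Remark)] -/
theorem isSepQuotient_pieceMap_of_index_eq [∀ c, Mono (eK c)] {c₁ c₂ : CK} (h : c₁ = c₂) (p₁ : E ⟶ EK c₁) (p₂ : E ⟶ EK c₂)
    (hp : p₁ ≫ eK c₁ = p₂ ≫ eK c₂) (h₁ : IsSepQuotient act p₁) : IsSepQuotient act p₂ := by
  subst h
  rw [cancel_mono] at hp
  rwa [← hp]

/-! ## §2 Pinned rows along an index equality -/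

/-- **Two pinned pull-back rows into the same piece agree**: let `p₁ : E → E_K c₁`, `p₂ : E → E_K c₂` lie over one ambient map
(`e_K` monomorphisms, `c₁ = c₂`), `p₂` a quotient by `act` for separated test objects, `E` with a rational point `P₀`; if
`x₁ : J_K c₁ → J_E`, `x₂ : J_K c₂ → J_E` satisfy `Nm_{p₁} ≫ x₁ = S = Nm_{p₂} ≫ x₂` (e.g. both `= Σ_{h ∈ H} Nm_h`, the pinned pull-backs
of one Galois piece cover chosen twice), then `πY_K c₁ ≫ x₁ = πY_K c₂ ≫ x₂` — `p₁ = p₂` after transport and `Nm_p` is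
right-cancellable (★ `Jacobian.eq_of_pushforward_comp_eq`). [cite: LangeRodriguez2022, §3.5.1 Prop. 3.5.1 (p. 65)]
[cite: Lange2023AbelianVarietiesComplex, §4.5.2 (the norm map N_f) and Thm. 4.5.1] [cite: MumfordAV1970, §19 (Hom(X,Y), first paragraph)] -/
theorem fan_row_eq_of_pinned_of_index_eq [∀ c, Mono (eK c)] (P₀ : AlgPoints E L) {c₁ c₂ : CK} (h : c₁ = c₂)
    (p₁ : E ⟶ EK c₁) (p₂ : E ⟶ EK c₂) (hp : p₁ ≫ eK c₁ = p₂ ≫ eK c₂) (hq : IsSepQuotient act p₂)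
    {S : J.J ⟶ J.J} (x₁ : (JK c₁).J ⟶ J.J) (x₂ : (JK c₂).J ⟶ J.J)
    (hx₁ : J.pushforward (JK c₁) p₁ ≫ x₁ = S) (hx₂ : J.pushforward (JK c₂) p₂ ≫ x₂ = S) :
    πK c₁ ≫ x₁ = πK c₂ ≫ x₂ := by
  subst h
  rw [cancel_mono] at hp
  subst hp
  rw [Jacobian.eq_of_pushforward_comp_eq J (JK c₁) act p₁ hq P₀ (hx₁.trans hx₂.symm)]

/-- **The same over an algebraically closed field**, for `E` smooth projective (geometrically irreducible): the rational point exists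
(★ `IsSmoothProjective.nonempty_algPoints`). [cite: LangeRodriguez2022, §3.5.1 Prop. 3.5.1 (p. 65)]
[cite: Lange2023AbelianVarietiesComplex, §4.5.2 (the norm map N_f) and Thm. 4.5.1] -/
theorem fan_row_eq_of_pinned_of_index_eq_of_isSmoothProjective [IsAlgClosed L] [∀ c, Mono (eK c)] {n : ℕ}
    (hE : IsSmoothProjective n E) {c₁ c₂ : CK} (h : c₁ = c₂)
    (p₁ : E ⟶ EK c₁) (p₂ : E ⟶ EK c₂) (hp : p₁ ≫ eK c₁ = p₂ ≫ eK c₂) (hq : IsSepQuotient act p₂)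
    {S : J.J ⟶ J.J} (x₁ : (JK c₁).J ⟶ J.J) (x₂ : (JK c₂).J ⟶ J.J)
    (hx₁ : J.pushforward (JK c₁) p₁ ≫ x₁ = S) (hx₂ : J.pushforward (JK c₂) p₂ ≫ x₂ = S) :
    πK c₁ ≫ x₁ = πK c₂ ≫ x₂ := by
  obtain ⟨P₀⟩ := hE.nonempty_algPoints L
  exact fan_row_eq_of_pinned_of_index_eq eK JK πK J act P₀ h p₁ p₂ hp hq x₁ x₂ hx₁ hx₂

/-! ## §3 The whole entry: row, norm of the second piece map, and the two fan legs -/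

/-- **Matching one fan-word entry along equal indices (the `hfd` letter, homogeneous form).**  With the pinned rows `x₁`, `x₂` of §2
over the pieces `a₁ = a₂` and two piece maps `r₁ : E → E_K d₁`, `r₂ : E → E_K d₂` over one ambient map (`d₁ = d₂`):
`πY_K a₁ ≫ (x₁ ≫ Nm_{r₁}) ≫ ιY_K d₁ = πY_K a₂ ≫ (x₂ ≫ Nm_{r₂}) ≫ ιY_K d₂` in `End(Y_K)` — §2 for the head, ★
`pushforward_comp_inj_eq_of_index_eq` (`Nm_{r₁} ≫ ι d₁ = Nm_{r₂} ≫ ι d₂`) for the tail.  In the d6 glue: `a₁ = b″ (ch c′)`, `a₂ = φ γ c′`,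
`d₁ = φ″ (ch c′)`, `d₂ = bN c′`, `x₁ = ttH″ (ch c′)` (the brick's row), `x₂ = tz` (★ `Jacobian.exists_entry_levelAdjoint`'s pull-back,
chosen with the brick's piece group), `r₁ = tp″ (ch c′)`, `r₂ = tq′ c′ ≫ tu c′`. [cite: Lange2023AbelianVarietiesComplex, §4.5.2 (the norm map N_f)]
[cite: GortzWedhorn2020, §(3.5) Proposition 3.10 and Example 3.11 (p. 73)] [cite: MumfordAV1970, §19 (Hom(X,Y), first paragraph)] -/
theorem fan_entry_eq_of_pinned_of_index_eq [∀ c, Mono (eK c)] (P₀ : AlgPoints E L)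
    {a₁ a₂ : CK} (ha : a₁ = a₂) (p₁ : E ⟶ EK a₁) (p₂ : E ⟶ EK a₂) (hp : p₁ ≫ eK a₁ = p₂ ≫ eK a₂)
    (hq : IsSepQuotient act p₂) {S : J.J ⟶ J.J} (x₁ : (JK a₁).J ⟶ J.J) (x₂ : (JK a₂).J ⟶ J.J)
    (hx₁ : J.pushforward (JK a₁) p₁ ≫ x₁ = S) (hx₂ : J.pushforward (JK a₂) p₂ ≫ x₂ = S)
    {d₁ d₂ : CK} (hd : d₁ = d₂) (r₁ : E ⟶ EK d₁) (r₂ : E ⟶ EK d₂) (hr : r₁ ≫ eK d₁ = r₂ ≫ eK d₂) :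
    πK a₁ ≫ (x₁ ≫ J.pushforward (JK d₁) r₁) ≫ ιK d₁ = πK a₂ ≫ (x₂ ≫ J.pushforward (JK d₂) r₂) ≫ ιK d₂ := by
  have hrow := fan_row_eq_of_pinned_of_index_eq eK JK πK J act P₀ ha p₁ p₂ hp hq x₁ x₂ hx₁ hx₂
  have htail := pushforward_comp_inj_eq_of_index_eq eK JK ιK J hd r₁ r₂ hr
  calc πK a₁ ≫ (x₁ ≫ J.pushforward (JK d₁) r₁) ≫ ιK d₁
      = (πK a₁ ≫ x₁) ≫ (J.pushforward (JK d₁) r₁ ≫ ιK d₁) := by simp only [Category.assoc]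
    _ = (πK a₂ ≫ x₂) ≫ (J.pushforward (JK d₂) r₂ ≫ ιK d₂) := by rw [hrow, htail]
    _ = πK a₂ ≫ (x₂ ≫ J.pushforward (JK d₂) r₂) ≫ ιK d₂ := by simp only [Category.assoc]

/-- **The same entry carried with an integer multiplicity** (`tt := (m : ℤ) • ttH`, the (G3)/(P-ii) currency; the scalar may sit on the
row or on the whole entry): `πY_K a₁ ≫ (((m:ℤ) • x₁) ≫ Nm_{r₁}) ≫ ιY_K d₁ = πY_K a₂ ≫ ((m:ℤ) • (x₂ ≫ Nm_{r₂})) ≫ ιY_K d₂`.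
[cite: Lange2023AbelianVarietiesComplex, §4.5.2 (the norm map N_f)] [cite: MumfordAV1970, §19 (Hom(X,Y), first paragraph)] -/
theorem fan_entry_eq_of_pinned_of_index_eq_smul [∀ c, Mono (eK c)] (P₀ : AlgPoints E L)
    {a₁ a₂ : CK} (ha : a₁ = a₂) (p₁ : E ⟶ EK a₁) (p₂ : E ⟶ EK a₂) (hp : p₁ ≫ eK a₁ = p₂ ≫ eK a₂)
    (hq : IsSepQuotient act p₂) {S : J.J ⟶ J.J} (x₁ : (JK a₁).J ⟶ J.J) (x₂ : (JK a₂).J ⟶ J.J)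
    (hx₁ : J.pushforward (JK a₁) p₁ ≫ x₁ = S) (hx₂ : J.pushforward (JK a₂) p₂ ≫ x₂ = S)
    {d₁ d₂ : CK} (hd : d₁ = d₂) (r₁ : E ⟶ EK d₁) (r₂ : E ⟶ EK d₂) (hr : r₁ ≫ eK d₁ = r₂ ≫ eK d₂) (m : ℤ) :
    πK a₁ ≫ ((m • x₁) ≫ J.pushforward (JK d₁) r₁) ≫ ιK d₁ = πK a₂ ≫ (m • (x₂ ≫ J.pushforward (JK d₂) r₂)) ≫ ιK d₂ := by
  rw [Preadditive.zsmul_comp, Preadditive.zsmul_comp, Preadditive.comp_zsmul, Preadditive.zsmul_comp, Preadditive.comp_zsmul,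
    fan_entry_eq_of_pinned_of_index_eq eK JK πK ιK J act P₀ ha p₁ p₂ hp hq x₁ x₂ hx₁ hx₂ hd r₁ r₂ hr]

/-- **The entry matching over an algebraically closed field**, for `E` smooth projective: the rational point exists.
[cite: Lange2023AbelianVarietiesComplex, §4.5.2 (the norm map N_f) and Thm. 4.5.1] [cite: GortzWedhorn2020, §(3.5) Proposition 3.10 and Example 3.11 (p. 73)] -/
theorem fan_entry_eq_of_pinned_of_index_eq_of_isSmoothProjective [IsAlgClosed L] [∀ c, Mono (eK c)] {n : ℕ}
    (hE : IsSmoothProjective n E)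
    {a₁ a₂ : CK} (ha : a₁ = a₂) (p₁ : E ⟶ EK a₁) (p₂ : E ⟶ EK a₂) (hp : p₁ ≫ eK a₁ = p₂ ≫ eK a₂)
    (hq : IsSepQuotient act p₂) {S : J.J ⟶ J.J} (x₁ : (JK a₁).J ⟶ J.J) (x₂ : (JK a₂).J ⟶ J.J)
    (hx₁ : J.pushforward (JK a₁) p₁ ≫ x₁ = S) (hx₂ : J.pushforward (JK a₂) p₂ ≫ x₂ = S)
    {d₁ d₂ : CK} (hd : d₁ = d₂) (r₁ : E ⟶ EK d₁) (r₂ : E ⟶ EK d₂) (hr : r₁ ≫ eK d₁ = r₂ ≫ eK d₂) (m : ℤ) :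
    πK a₁ ≫ ((m • x₁) ≫ J.pushforward (JK d₁) r₁) ≫ ιK d₁ = πK a₂ ≫ (m • (x₂ ≫ J.pushforward (JK d₂) r₂)) ≫ ιK d₂ := by
  obtain ⟨P₀⟩ := hE.nonempty_algPoints L
  exact fan_entry_eq_of_pinned_of_index_eq_smul eK JK πK ιK J act P₀ ha p₁ p₂ hp hq x₁ x₂ hx₁ hx₂ hd r₁ r₂ hr m

end Literature.NumberTheory.Automorphic.Liu2021.AppendixC

end
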